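import Literature.Analysis.Calculus.AxisPoincareHomotopyFormula
import Literature.Analysis.FunctionSpaces.ParametricIntegralSmooth
import HarnessLib

/-!
# Smoothness of the linear-homotopy operator and the homotopy formula for smooth closed forms

Topic `Analysis/Calculus`; namespace `Literature.Analysis.Calculus`.  Theorems only; no named fact,
no `sorry`.  For the operator `K = axisPrimitive P` of `AxisPoincareHomotopy.lean`:

* `contDiff_intervalIntegral_of_contDiff` — `y ↦ ∫₀¹ G(t, y) dt` is `C^∞` for `G` smooth jointly
  (the tree's `contDiff_parametric_integral` over the finite measure `volume|(0,1]`);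
* `contDiff_axisIntegralA`, `contDiff_conePrimitive_base`, **`contDiff_axisPrimitive`** — `K τ` is
  `C^∞` on `E` when `τ` is (finite-dimensional `E`);
* **`extDeriv_axisPrimitive_of_contDiff`** — the homotopy formula
  `d(K τ)(y) = τ(y) - τ(P y) ∘ (P × P)` for smooth closed `τ` on all of `E`, the hypotheses of
  `extDeriv_axisPrimitive_of_closed` being discharged by compactness
  (`exists_bound_segments`), and its rank-one case `d(K τ) = τ`
  (`extDeriv_axisPrimitive_of_contDiff_of_apply_base`).

These are the inputs of the normal-form gluing along zero circles of near-symplectic forms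
(`Literature/Geometry/Symplectic`), where `τ = Θ_A - ω` in tube coordinates, cut off to a smooth
form on `ℝ × ℝ³`.

## References

* R. Bott, L. W. Tu, *Differential Forms in Algebraic Topology*, GTM 82 (1982), I §4, §6. [BottTu1982]
* L. Hörmander, *The Analysis of Linear Partial Differential Operators I*, 2nd ed. (1990),
  Thm. 1.1.9.
-/

noncomputable section

open Set MeasureTheory intervalIntegral Filter Topology Metric
open scoped Interval ContDiff

namespace Literature.Analysis.Calculus

variable {E F : Type*} [NormedAddCommGroup E] [NormedSpace ℝ E] [NormedAddCommGroup F]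
  [NormedSpace ℝ F]

/-! ### Smooth parametric interval integrals -/

/-- **`y ↦ ∫₀¹ G(t, y) dt` is smooth for `G : ℝ × E → F'` smooth** (`E` finite dimensional):
the tree's `contDiff_parametric_integral` for the finite measure `volume|(0, 1]` and the compact
set `[0, 1]`. [folklore] -/
theorem contDiff_intervalIntegral_of_contDiff [FiniteDimensional ℝ E] {F' : Type*}
    [NormedAddCommGroup F'] [NormedSpace ℝ F'] {G : ℝ × E → F'} (hG : ContDiff ℝ ∞ G) :
    ContDiff ℝ ∞ fun y : E ↦ ∫ t in (0 : ℝ)..1, G (t, y) := by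
  have h1 : (fun y : E ↦ ∫ t in (0 : ℝ)..1, G (t, y)) =
      fun y : E ↦ ∫ t, G (id t, y) ∂(volume.restrict (Ioc (0 : ℝ) 1)) := by
    funext y; rw [intervalIntegral.integral_of_le zero_le_one]; rfl
  rw [h1]
  haveI : IsFiniteMeasure (volume.restrict (Ioc (0 : ℝ) 1)) :=
    ⟨by simp [Real.volume_Ioc]⟩
  refine Literature.Analysis.FunctionSpaces.contDiff_parametric_integral
    (μ := volume.restrict (Ioc (0 : ℝ) 1)) (K := Icc (0 : ℝ) 1) measurable_id isCompact_Icc ?_ hG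
  exact (ae_restrict_mem measurableSet_Ioc).mono fun t ht ↦ Ioc_subset_Icc_self ht

/-- The linear homotopy `(t, y) ↦ h_t(y) = P y + t (y - P y)` is smooth jointly. [folklore] -/
theorem contDiff_conePt_base (P : E →L[ℝ] E) :
    ContDiff ℝ ∞ fun q : ℝ × E ↦ conePt (P q.2) q.2 q.1 := by
  have h : (fun q : ℝ × E ↦ conePt (P q.2) q.2 q.1) =
      fun q : ℝ × E ↦ P q.2 + q.1 • (q.2 - P q.2) := by
    funext q; rfl
  rw [h]
  exact (P.contDiff.comp contDiff_snd).add
    (contDiff_fst.smul (contDiff_snd.sub (P.contDiff.comp contDiff_snd)))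

/-- The integrands `(t, y) ↦ tᵏ · τ(h_t y).curryLeft (y - P y)` are smooth jointly for smooth `τ`.
[folklore] -/
theorem contDiff_axisIntegrand (P : E →L[ℝ] E) {τ : E → E [⋀^Fin 2]→L[ℝ] F}
    (hτ : ContDiff ℝ ∞ τ) (k : ℕ) :
    ContDiff ℝ ∞ fun q : ℝ × E ↦
      (q.1 ^ k) • (τ (conePt (P q.2) q.2 q.1)).curryLeft (q.2 - P q.2) := by
  have hL := LinearIsometry.contDiff (𝕜 := ℝ) (n := ∞) (E := E [⋀^Fin 2]→L[ℝ] F)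
    (F := E →L[ℝ] E [⋀^Fin 1]→L[ℝ] F) ContinuousAlternatingMap.curryLeftLI
  have h1 := hL.comp (hτ.comp (contDiff_conePt_base P))
  have h2 : ContDiff ℝ ∞ fun q : ℝ × E ↦ q.2 - P q.2 :=
    contDiff_snd.sub (P.contDiff.comp contDiff_snd)
  have h4 := ((contDiff_fst (E := ℝ) (F := E)).pow k).fun_smul (h1.clm_apply h2)
  simpa [Function.comp_def] using h4

/-- **The `P`-part `A` of the operator is smooth** for smooth `τ`. [folklore] -/
theorem contDiff_axisIntegralA [FiniteDimensional ℝ E] (P : E →L[ℝ] E)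
    {τ : E → E [⋀^Fin 2]→L[ℝ] F} (hτ : ContDiff ℝ ∞ τ) : ContDiff ℝ ∞ (axisIntegralA P τ) := by
  have h := contDiff_intervalIntegral_of_contDiff (contDiff_axisIntegrand P hτ 0)
  simp only [pow_zero, one_smul] at h
  exact h

/-- **The cone part with moving base point is smooth** for smooth `τ`. [folklore] -/
theorem contDiff_conePrimitive_base [FiniteDimensional ℝ E] (P : E →L[ℝ] E)
    {τ : E → E [⋀^Fin 2]→L[ℝ] F} (hτ : ContDiff ℝ ∞ τ) :
    ContDiff ℝ ∞ fun y : E ↦ conePrimitive (P y) τ y := by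
  have h := contDiff_intervalIntegral_of_contDiff (contDiff_axisIntegrand P hτ 1)
  exact h

/-- **The linear-homotopy operator preserves smoothness**: `K τ` is `C^∞` for `τ` `C^∞`
(`E` finite dimensional). [cite: BottTu1982, I §6] -/
theorem contDiff_axisPrimitive [FiniteDimensional ℝ E] (P : E →L[ℝ] E)
    {τ : E → E [⋀^Fin 2]→L[ℝ] F} (hτ : ContDiff ℝ ∞ τ) : ContDiff ℝ ∞ (axisPrimitive P τ) := by
  have h1 := (ContinuousAlternatingMap.compContinuousLinearMapCLM (ι := Fin 1) (F := F) P).contDiff.comp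
    (contDiff_axisIntegralA P hτ)
  have h2 := (ContinuousAlternatingMap.compContinuousLinearMapCLM (ι := Fin 1) (F := F)
    (ContinuousLinearMap.id ℝ E - P)).contDiff.comp (contDiff_conePrimitive_base P hτ)
  have heq : axisPrimitive P τ = fun y ↦
      (⇑(ContinuousAlternatingMap.compContinuousLinearMapCLM (ι := Fin 1) (F := F) P) ∘
          axisIntegralA P τ) y +
        (⇑(ContinuousAlternatingMap.compContinuousLinearMapCLM (ι := Fin 1) (F := F)
            (ContinuousLinearMap.id ℝ E - P)) ∘ fun y ↦ conePrimitive (P y) τ y) y := by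
    funext y
    simp only [Function.comp_apply, axisPrimitive,
      ContinuousAlternatingMap.compContinuousLinearMapCLM_apply]
  rw [heq]
  exact h1.add h2

/-! ### The homotopy formula for smooth closed forms -/

/-- Uniform bounds of two continuous functions on the segments `[P y', y']`, `y' ∈ ball y 1`
(finite-dimensional `E`: the segments lie in the image of a compact set). [folklore] -/
theorem exists_bound_segments [FiniteDimensional ℝ E] (P : E →L[ℝ] E) {G₁ G₂ : Type*}
    [NormedAddCommGroup G₁] [NormedAddCommGroup G₂] {f : E → G₁} {g : E → G₂} (hf : Continuous f)
    (hg : Continuous g) (y : E) :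
    ∃ C : ℝ, ∀ y' ∈ ball y 1, ∀ t ∈ Icc (0 : ℝ) 1,
      ‖f (conePt (P y') y' t)‖ ≤ C ∧ ‖g (conePt (P y') y' t)‖ ≤ C := by
  have hK : IsCompact ((Icc (0 : ℝ) 1) ×ˢ closedBall y 1) :=
    isCompact_Icc.prod (isCompact_closedBall y 1)
  have hc : Continuous fun q : ℝ × E ↦ conePt (P q.2) q.2 q.1 := (contDiff_conePt_base P).continuous
  obtain ⟨C₁, hC₁⟩ := (hK.image (hf.comp hc)).isBounded.exists_norm_le
  obtain ⟨C₂, hC₂⟩ := (hK.image (hg.comp hc)).isBounded.exists_norm_le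
  refine ⟨max C₁ C₂, fun y' hy' t ht ↦ ⟨?_, ?_⟩⟩
  · exact (hC₁ _ ⟨(t, y'), ⟨ht, mem_closedBall.2 (mem_ball.1 hy').le⟩, rfl⟩).trans (le_max_left _ _)
  · exact (hC₂ _ ⟨(t, y'), ⟨ht, mem_closedBall.2 (mem_ball.1 hy').le⟩, rfl⟩).trans (le_max_right _ _)

variable [CompleteSpace F]

/-- **Homotopy formula for smooth closed `2`-forms**:
`d(K τ)(y)(v, w) = τ(y)(v, w) - τ(P y)(P v, P w)` for `τ` of class `C^∞` on `E` with `dτ = 0`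
(`E` finite dimensional). [cite: BottTu1982, I §4] -/
theorem extDeriv_axisPrimitive_apply_of_contDiff [FiniteDimensional ℝ E] (P : E →L[ℝ] E)
    {τ : E → E [⋀^Fin 2]→L[ℝ] F} (hτ : ContDiff ℝ ∞ τ) (hclosed : ∀ x, extDeriv τ x = 0)
    (y v w : E) :
    extDeriv (axisPrimitive P τ) y ![v, w] = τ y ![v, w] - τ (P y) ![P v, P w] := by
  have h1 : (∞ : WithTop ℕ∞) ≠ 0 := by exact_mod_cast WithTop.coe_ne_zero.2 (by decide)
  have hd : ∀ x ∈ (univ : Set E), HasFDerivAt τ (fderiv ℝ τ x) x := fun x _ ↦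
    ((hτ.differentiable h1) x).hasFDerivAt
  obtain ⟨C, hC⟩ := exists_bound_segments P hτ.continuous (hτ.continuous_fderiv h1) y
  exact extDeriv_axisPrimitive_apply_of_closed convex_univ (fun _ _ ↦ mem_univ _) hd
    hτ.continuous.continuousOn (hτ.continuous_fderiv h1).continuousOn (fun x _ ↦ hclosed x)
    one_pos (subset_univ _) hC v w

/-- **`d(K τ) = τ - h₀* τ`** for smooth closed `2`-forms, as an identity of forms.
[cite: BottTu1982, I §4] -/
theorem extDeriv_axisPrimitive_of_contDiff [FiniteDimensional ℝ E] (P : E →L[ℝ] E)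
    {τ : E → E [⋀^Fin 2]→L[ℝ] F} (hτ : ContDiff ℝ ∞ τ) (hclosed : ∀ x, extDeriv τ x = 0) (y : E) :
    extDeriv (axisPrimitive P τ) y = τ y - (τ (P y)).compContinuousLinearMap P := by
  ext m
  have hm : m = ![m 0, m 1] := by funext i; fin_cases i <;> rfl
  rw [hm, extDeriv_axisPrimitive_apply_of_contDiff P hτ hclosed,
    ContinuousAlternatingMap.sub_apply, ContinuousAlternatingMap.compContinuousLinearMap_apply,
    comp_vecCons_two]

/-- **The relative Poincaré lemma along the axis, smooth version**: if moreover `τ ∘ P` vanishes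
on pairs from `range P` (e.g. `P` of rank `≤ 1`), then `K τ` is a smooth primitive of `τ`:
`d(K τ) = τ` on `E`. [cite: BottTu1982, I §6] -/
theorem extDeriv_axisPrimitive_of_contDiff_of_apply_base [FiniteDimensional ℝ E] (P : E →L[ℝ] E)
    {τ : E → E [⋀^Fin 2]→L[ℝ] F} (hτ : ContDiff ℝ ∞ τ) (hclosed : ∀ x, extDeriv τ x = 0)
    (h0 : ∀ y v w : E, τ (P y) ![P v, P w] = 0) (y : E) :
    extDeriv (axisPrimitive P τ) y = τ y := by
  ext m
  have hm : m = ![m 0, m 1] := by funext i; fin_cases i <;> rfl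
  rw [hm, extDeriv_axisPrimitive_apply_of_contDiff P hτ hclosed, h0, sub_zero]

omit [CompleteSpace F] in
/-- **Rank-one maps kill `2`-forms on their range**: if `range P` is contained in a line `ℝ ∙ e`,
then `f(P v, P w) = 0` for every `2`-form `f`. [folklore] -/
theorem apply_pair_eq_zero_of_range_subset_span (P : E →L[ℝ] E) {e : E}
    (hP : ∀ v, ∃ c : ℝ, P v = c • e) (f : E [⋀^Fin 2]→L[ℝ] F) (v w : E) :
    f ![P v, P w] = 0 := by
  obtain ⟨a, ha⟩ := hP v
  obtain ⟨b, hb⟩ := hP w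
  have hee : f ![e, e] = 0 :=
    f.map_eq_zero_of_eq ![e, e] (by simp) (show (0 : Fin 2) ≠ 1 by decide)
  rw [ha, hb, apply_vecCons_smul_left, apply_vecCons_smul, hee, smul_zero, smul_zero]

end Literature.Analysis.Calculus

end
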